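import Mathlib
import Summits.Ventures.PercRepro2.MixChordDecompDefs

/-!
# The exploration-martingale decomposition of the (MIX-CHORD) deficit (blind cell PercRepro2,
night-1 g19; proofs/NIGHT1-G19.md §3; vocabulary in `MixChordDecompDefs.lean`)

Write `G = Gc / (D·Z) = Z·A − D·B` with `A = Cov_Q(σ_b, F)`, `B = Cov_PD(1_{bU}, 1_{oU})`,
`F = σ_o + σ₃(γ − 1_{oU})`, `γ = D_o / D` (`Gcond`, `covQ`, `covPD`, `gam`).  Along ANY edge `e`
every mass is the mixture `q·M¹ + (1 − q)·M⁰` of its values at `p[e ↦ 1]`, `p[e ↦ 0]`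
(`prob_eq_pin`), and the law of total covariance for the status of `e` under `P(·|Q)` and
`P(·|PD)` (`totalCov_mix`) gives the EXACT identity

**`decomp`**: `G − q·G¹ − (1 − q)·G⁰ = T_γ + T_Q + T_PD`,

`T_Q = Z·π(1 − π)·(E_{Q¹}[σ_b] − E_{Q⁰}[σ_b])·(E_{Q¹}[F] − E_{Q⁰}[F])` (both `F` at the parent's
`γ`; `π = q·Z¹/Z = P(e open | Q)`), `T_PD = −D·π_D(1 − π_D)·(P(bU|PD¹) − P(bU|PD⁰))·(P(oU|PD¹) −
P(oU|PD⁰))` (`π_D = q·D¹/D`), `T_γ = −(γ¹ − γ⁰)·[q·Z¹(1 − π_D)·C¹ − (1 − q)·Z⁰·π_D·C⁰]` with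
`C = Cov_Q(σ_b, σ₃)` (`covQ3`) — the children's `F` use their own `γ`.

**`mixChord_edge_iff`**: (MIX-CHORD) along `e` ⟺ `T_γ + T_Q + T_PD ≥ −q·(1 − D¹Z¹/(D·Z))·G¹`.
`T_Q ≥ 0` along every root edge at `a₁` (`MixChordPieces.condMean_sb_update_ge` for `Δσ_b`;
`ΔF ≥ 0` census-true), `C⁰, C¹ ≥ 0` (`covQ_sb_s3_nonneg`); `T_PD` and `T_γ` are indefinite.

Own code; standard axioms.
-/

namespace Summit.Ventures.PercRepro2

open UnionCluster CovForm

namespace Mix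

section Decomp

variable {V : Type*} {E : Type*} [Fintype E] [DecidableEq E] [DecidableEq V] {R : Type*}
  [Field R] [LinearOrder R] [IsStrictOrderedRing R]

variable (p : E → R) (ends : E → Sym2 V) (o a₁ a₂ a₃ b : V) (e : E)

omit [DecidableEq V] in
/-- **The exploration-martingale decomposition** along any edge `e` (all six normalisers nonzero):
`G − q G¹ − (1 − q) G⁰ = T_γ + T_Q + T_PD`. -/
theorem decomp
    (hD : prob p (PDEvent ends a₁ a₂ a₃) ≠ 0) (hZ : prob p (avoidAll ends a₂ {a₁}) ≠ 0)
    (hD1 : prob (Function.update p e 1) (PDEvent ends a₁ a₂ a₃) ≠ 0)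
    (hZ1 : prob (Function.update p e 1) (avoidAll ends a₂ {a₁}) ≠ 0)
    (hD0 : prob (Function.update p e 0) (PDEvent ends a₁ a₂ a₃) ≠ 0)
    (hZ0 : prob (Function.update p e 0) (avoidAll ends a₂ {a₁}) ≠ 0) :
    Gcond p ends o a₁ a₂ a₃ b (gam p ends o a₁ a₂ a₃) -
        p e * Gcond (Function.update p e 1) ends o a₁ a₂ a₃ b
          (gam (Function.update p e 1) ends o a₁ a₂ a₃) -
        (1 - p e) * Gcond (Function.update p e 0) ends o a₁ a₂ a₃ b
          (gam (Function.update p e 0) ends o a₁ a₂ a₃) =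
      -- `T_γ`
      -(gam (Function.update p e 1) ends o a₁ a₂ a₃ - gam (Function.update p e 0) ends o a₁ a₂ a₃) *
          (p e * prob (Function.update p e 1) (avoidAll ends a₂ {a₁}) *
              (1 - p e * prob (Function.update p e 1) (PDEvent ends a₁ a₂ a₃) /
                prob p (PDEvent ends a₁ a₂ a₃)) *
              covQ3 (Function.update p e 1) ends a₁ a₂ a₃ b -
            (1 - p e) * prob (Function.update p e 0) (avoidAll ends a₂ {a₁}) *
              (p e * prob (Function.update p e 1) (PDEvent ends a₁ a₂ a₃) /
                prob p (PDEvent ends a₁ a₂ a₃)) *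
              covQ3 (Function.update p e 0) ends a₁ a₂ a₃ b) +
      -- `T_Q`
      prob p (avoidAll ends a₂ {a₁}) *
          (p e * prob (Function.update p e 1) (avoidAll ends a₂ {a₁}) /
            prob p (avoidAll ends a₂ {a₁})) *
          (1 - p e * prob (Function.update p e 1) (avoidAll ends a₂ {a₁}) /
            prob p (avoidAll ends a₂ {a₁})) *
          (condEsb (Function.update p e 1) ends a₁ a₂ b - condEsb (Function.update p e 0) ends a₁ a₂ b) *
          (condEF (Function.update p e 1) ends o a₁ a₂ a₃ (gam p ends o a₁ a₂ a₃) -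
            condEF (Function.update p e 0) ends o a₁ a₂ a₃ (gam p ends o a₁ a₂ a₃)) +
      -- `T_PD`
      -(prob p (PDEvent ends a₁ a₂ a₃) *
          (p e * prob (Function.update p e 1) (PDEvent ends a₁ a₂ a₃) /
            prob p (PDEvent ends a₁ a₂ a₃)) *
          (1 - p e * prob (Function.update p e 1) (PDEvent ends a₁ a₂ a₃) /
            prob p (PDEvent ends a₁ a₂ a₃)) *
          (PDb (Function.update p e 1) ends a₁ a₂ a₃ b /
              prob (Function.update p e 1) (PDEvent ends a₁ a₂ a₃) -
            PDb (Function.update p e 0) ends a₁ a₂ a₃ b /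
              prob (Function.update p e 0) (PDEvent ends a₁ a₂ a₃)) *
          (Do (Function.update p e 1) ends o a₁ a₂ a₃ /
              prob (Function.update p e 1) (PDEvent ends a₁ a₂ a₃) -
            Do (Function.update p e 0) ends o a₁ a₂ a₃ /
              prob (Function.update p e 0) (PDEvent ends a₁ a₂ a₃))) := by
  have hZp := prob_eq_pin p (avoidAll ends a₂ {a₁}) e
  have hDp := prob_eq_pin p (PDEvent ends a₁ a₂ a₃) e
  have h5 := gam_mix p ends o a₁ a₂ a₃ e hD hD1 hD0
  set γ := gam p ends o a₁ a₂ a₃ with hγ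
  set γ₁ := gam (Function.update p e 1) ends o a₁ a₂ a₃ with hγ₁
  set γ₀ := gam (Function.update p e 0) ends o a₁ a₂ a₃ with hγ₀
  -- the Q-part: the law of total covariance for `(σ_b, F)` at the parent's `γ`
  have hQ : prob p (avoidAll ends a₂ {a₁}) * covQ p ends o a₁ a₂ a₃ b γ -
      p e * prob (Function.update p e 1) (avoidAll ends a₂ {a₁}) *
        covQ (Function.update p e 1) ends o a₁ a₂ a₃ b γ -
      (1 - p e) * prob (Function.update p e 0) (avoidAll ends a₂ {a₁}) *
        covQ (Function.update p e 0) ends o a₁ a₂ a₃ b γ =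
      prob p (avoidAll ends a₂ {a₁}) *
        (p e * prob (Function.update p e 1) (avoidAll ends a₂ {a₁}) /
          prob p (avoidAll ends a₂ {a₁})) *
        (1 - p e * prob (Function.update p e 1) (avoidAll ends a₂ {a₁}) /
          prob p (avoidAll ends a₂ {a₁})) *
        (condEsb (Function.update p e 1) ends a₁ a₂ b - condEsb (Function.update p e 0) ends a₁ a₂ b) *
        (condEF (Function.update p e 1) ends o a₁ a₂ a₃ γ -
          condEF (Function.update p e 0) ends o a₁ a₂ a₃ γ) := by
    have h1 := totalCov_mix (p e) (prob (Function.update p e 1) (avoidAll ends a₂ {a₁}))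
      (prob (Function.update p e 0) (avoidAll ends a₂ {a₁}))
      (-gap (Function.update p e 1) ends a₁ a₂ b) (-gap (Function.update p e 0) ends a₁ a₂ b)
      (EQo (Function.update p e 1) ends o a₁ a₂ + γ * EQ3 (Function.update p e 1) ends a₁ a₂ a₃ -
        EQ3o (Function.update p e 1) ends o a₁ a₂ a₃)
      (EQo (Function.update p e 0) ends o a₁ a₂ + γ * EQ3 (Function.update p e 0) ends a₁ a₂ a₃ -
        EQ3o (Function.update p e 0) ends o a₁ a₂ a₃)
      (EQbo (Function.update p e 1) ends o a₁ a₂ b + γ * EQb3 (Function.update p e 1) ends a₁ a₂ a₃ b -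
        EQb3o (Function.update p e 1) ends o a₁ a₂ a₃ b)
      (EQbo (Function.update p e 0) ends o a₁ a₂ b + γ * EQb3 (Function.update p e 0) ends a₁ a₂ a₃ b -
        EQb3o (Function.update p e 0) ends o a₁ a₂ a₃ b) hZ1 hZ0 (hZp ▸ hZ)
    unfold covQ condEsbF condEsb condEF
    rw [EQb3_pin p ends a₁ a₂ a₃ b e, EQ3_pin p ends a₁ a₂ a₃ e, EQo_pin p ends o a₁ a₂ e,
      EQ3o_pin p ends o a₁ a₂ a₃ e, EQbo_pin p ends o a₁ a₂ b e, EQb3o_pin p ends o a₁ a₂ a₃ b e,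
      gap_pin p ends a₁ a₂ b e, hZp]
    linear_combination h1
  -- the PD-part: the law of total covariance for `(1_{bU}, 1_{oU})`
  have hPD : prob p (PDEvent ends a₁ a₂ a₃) * covPD p ends o a₁ a₂ a₃ b -
      p e * prob (Function.update p e 1) (PDEvent ends a₁ a₂ a₃) *
        covPD (Function.update p e 1) ends o a₁ a₂ a₃ b -
      (1 - p e) * prob (Function.update p e 0) (PDEvent ends a₁ a₂ a₃) *
        covPD (Function.update p e 0) ends o a₁ a₂ a₃ b =
      prob p (PDEvent ends a₁ a₂ a₃) *
        (p e * prob (Function.update p e 1) (PDEvent ends a₁ a₂ a₃) /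
          prob p (PDEvent ends a₁ a₂ a₃)) *
        (1 - p e * prob (Function.update p e 1) (PDEvent ends a₁ a₂ a₃) /
          prob p (PDEvent ends a₁ a₂ a₃)) *
        (PDb (Function.update p e 1) ends a₁ a₂ a₃ b /
            prob (Function.update p e 1) (PDEvent ends a₁ a₂ a₃) -
          PDb (Function.update p e 0) ends a₁ a₂ a₃ b /
            prob (Function.update p e 0) (PDEvent ends a₁ a₂ a₃)) *
        (Do (Function.update p e 1) ends o a₁ a₂ a₃ /
            prob (Function.update p e 1) (PDEvent ends a₁ a₂ a₃) -
          Do (Function.update p e 0) ends o a₁ a₂ a₃ /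
            prob (Function.update p e 0) (PDEvent ends a₁ a₂ a₃)) := by
    have h2 := totalCov_mix (p e) (prob (Function.update p e 1) (PDEvent ends a₁ a₂ a₃))
      (prob (Function.update p e 0) (PDEvent ends a₁ a₂ a₃))
      (PDb (Function.update p e 1) ends a₁ a₂ a₃ b) (PDb (Function.update p e 0) ends a₁ a₂ a₃ b)
      (Do (Function.update p e 1) ends o a₁ a₂ a₃) (Do (Function.update p e 0) ends o a₁ a₂ a₃)
      (PDbo (Function.update p e 1) ends o a₁ a₂ a₃ b) (PDbo (Function.update p e 0) ends o a₁ a₂ a₃ b)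
      hD1 hD0 (hDp ▸ hD)
    unfold covPD
    rw [PDb_pin p ends a₁ a₂ a₃ b e, PDbo_pin p ends o a₁ a₂ a₃ b e, Do_pin p ends o a₁ a₂ a₃ e, hDp]
    linear_combination h2
  -- `A` is affine in `γ` with slope `C`
  have haff1 : covQ (Function.update p e 1) ends o a₁ a₂ a₃ b γ₁ -
      covQ (Function.update p e 1) ends o a₁ a₂ a₃ b γ =
      (γ₁ - γ) * covQ3 (Function.update p e 1) ends a₁ a₂ a₃ b := by
    unfold covQ covQ3 condEsbF condEsb condEF
    ring
  have haff0 : covQ (Function.update p e 0) ends o a₁ a₂ a₃ b γ₀ -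
      covQ (Function.update p e 0) ends o a₁ a₂ a₃ b γ =
      (γ₀ - γ) * covQ3 (Function.update p e 0) ends a₁ a₂ a₃ b := by
    unfold covQ covQ3 condEsbF condEsb condEF
    ring
  have hG : Gcond p ends o a₁ a₂ a₃ b γ =
      prob p (avoidAll ends a₂ {a₁}) * covQ p ends o a₁ a₂ a₃ b γ -
        prob p (PDEvent ends a₁ a₂ a₃) * covPD p ends o a₁ a₂ a₃ b := rfl
  have hG1 : Gcond (Function.update p e 1) ends o a₁ a₂ a₃ b γ₁ =
      prob (Function.update p e 1) (avoidAll ends a₂ {a₁}) *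
          covQ (Function.update p e 1) ends o a₁ a₂ a₃ b γ₁ -
        prob (Function.update p e 1) (PDEvent ends a₁ a₂ a₃) *
          covPD (Function.update p e 1) ends o a₁ a₂ a₃ b := rfl
  have hG0 : Gcond (Function.update p e 0) ends o a₁ a₂ a₃ b γ₀ =
      prob (Function.update p e 0) (avoidAll ends a₂ {a₁}) *
          covQ (Function.update p e 0) ends o a₁ a₂ a₃ b γ₀ -
        prob (Function.update p e 0) (PDEvent ends a₁ a₂ a₃) *
          covPD (Function.update p e 0) ends o a₁ a₂ a₃ b := rfl
  rw [hG, hG1, hG0]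
  linear_combination hQ - hPD -
    (p e * prob (Function.update p e 1) (avoidAll ends a₂ {a₁})) * haff1 -
    ((1 - p e) * prob (Function.update p e 0) (avoidAll ends a₂ {a₁})) * haff0 +
    (p e * prob (Function.update p e 1) (avoidAll ends a₂ {a₁}) *
        covQ3 (Function.update p e 1) ends a₁ a₂ a₃ b +
      (1 - p e) * prob (Function.update p e 0) (avoidAll ends a₂ {a₁}) *
        covQ3 (Function.update p e 0) ends a₁ a₂ a₃ b) * h5

omit [DecidableEq V] in
/-- **(MIX-CHORD) along `e` in the language of the decomposition**: with all normalisers positive,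
`p_e·Gc¹ + (1 − p_e)·shrink·Gc⁰ ≤ Gc` ⟺ `G − p_e G¹ − (1 − p_e) G⁰ ≥ −p_e (1 − D¹Z¹/(D·Z)) G¹`. -/
theorem mixChord_edge_iff (hp : IsProbVec p)
    (hD : prob p (PDEvent ends a₁ a₂ a₃) ≠ 0) (hZ : prob p (avoidAll ends a₂ {a₁}) ≠ 0)
    (hD1 : prob (Function.update p e 1) (PDEvent ends a₁ a₂ a₃) ≠ 0)
    (hZ1 : prob (Function.update p e 1) (avoidAll ends a₂ {a₁}) ≠ 0)
    (hD0 : prob (Function.update p e 0) (PDEvent ends a₁ a₂ a₃) ≠ 0)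
    (hZ0 : prob (Function.update p e 0) (avoidAll ends a₂ {a₁}) ≠ 0) :
    (p e * Gc (Function.update p e 1) ends o a₁ a₂ a₃ b +
        (1 - p e) * (shrink p ends a₁ a₂ a₃ e * Gc (Function.update p e 0) ends o a₁ a₂ a₃ b) ≤
          Gc p ends o a₁ a₂ a₃ b) ↔
      -(p e) * (1 - prob (Function.update p e 1) (PDEvent ends a₁ a₂ a₃) *
            prob (Function.update p e 1) (avoidAll ends a₂ {a₁}) /
            (prob p (PDEvent ends a₁ a₂ a₃) * prob p (avoidAll ends a₂ {a₁}))) *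
          Gcond (Function.update p e 1) ends o a₁ a₂ a₃ b
            (gam (Function.update p e 1) ends o a₁ a₂ a₃) ≤
        Gcond p ends o a₁ a₂ a₃ b (gam p ends o a₁ a₂ a₃) -
          p e * Gcond (Function.update p e 1) ends o a₁ a₂ a₃ b
            (gam (Function.update p e 1) ends o a₁ a₂ a₃) -
          (1 - p e) * Gcond (Function.update p e 0) ends o a₁ a₂ a₃ b
            (gam (Function.update p e 0) ends o a₁ a₂ a₃) := by
  have hp0 : IsProbVec (Function.update p e 0) := hp.update e le_rfl zero_le_one
  have hp1 : IsProbVec (Function.update p e 1) := hp.update e zero_le_one le_rfl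
  rw [Gcond_eq p ends o a₁ a₂ a₃ b hD hZ, Gcond_eq _ ends o a₁ a₂ a₃ b hD1 hZ1,
    Gcond_eq _ ends o a₁ a₂ a₃ b hD0 hZ0]
  unfold shrink
  have hn : 0 < prob p (PDEvent ends a₁ a₂ a₃) * prob p (avoidAll ends a₂ {a₁}) :=
    lt_of_le_of_ne (mul_nonneg (prob_nonneg hp _) (prob_nonneg hp _)) (Ne.symm (mul_ne_zero hD hZ))
  have key : (prob p (PDEvent ends a₁ a₂ a₃) * prob p (avoidAll ends a₂ {a₁})) *
      ((Gc p ends o a₁ a₂ a₃ b / (prob p (PDEvent ends a₁ a₂ a₃) * prob p (avoidAll ends a₂ {a₁})) -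
          p e * (Gc (Function.update p e 1) ends o a₁ a₂ a₃ b /
            (prob (Function.update p e 1) (PDEvent ends a₁ a₂ a₃) *
              prob (Function.update p e 1) (avoidAll ends a₂ {a₁}))) -
          (1 - p e) * (Gc (Function.update p e 0) ends o a₁ a₂ a₃ b /
            (prob (Function.update p e 0) (PDEvent ends a₁ a₂ a₃) *
              prob (Function.update p e 0) (avoidAll ends a₂ {a₁})))) -
        -(p e) * (1 - prob (Function.update p e 1) (PDEvent ends a₁ a₂ a₃) *
            prob (Function.update p e 1) (avoidAll ends a₂ {a₁}) /
            (prob p (PDEvent ends a₁ a₂ a₃) * prob p (avoidAll ends a₂ {a₁}))) *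
          (Gc (Function.update p e 1) ends o a₁ a₂ a₃ b /
            (prob (Function.update p e 1) (PDEvent ends a₁ a₂ a₃) *
              prob (Function.update p e 1) (avoidAll ends a₂ {a₁})))) =
      Gc p ends o a₁ a₂ a₃ b -
        (p e * Gc (Function.update p e 1) ends o a₁ a₂ a₃ b +
          (1 - p e) * (prob p (PDEvent ends a₁ a₂ a₃) * prob p (avoidAll ends a₂ {a₁}) /
            (prob (Function.update p e 0) (PDEvent ends a₁ a₂ a₃) *
              prob (Function.update p e 0) (avoidAll ends a₂ {a₁})) *
            Gc (Function.update p e 0) ends o a₁ a₂ a₃ b)) := by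
    field_simp
    ring
  constructor
  · intro h
    rw [← sub_nonneg] at h ⊢
    rw [← key] at h
    exact nonneg_of_mul_nonneg_right h hn
  · intro h
    rw [← sub_nonneg] at h ⊢
    rw [← key]
    exact mul_nonneg hn.le h

end Decomp

end Mix

end Summit.Ventures.PercRepro2
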